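import Literature.Topology.FourManifolds.NeckCapping
import Literature.Topology.FourManifolds.SmoothEmbeddingCriteria
import Literature.Geometry.Manifold.SmoothEmbeddingInverse
import Mathlib.Analysis.SpecialFunctions.Log.Deriv
import Mathlib.Analysis.SpecialFunctions.ExpDeriv
import HarnessLib

/-!
# A cap and a tube agreeing in polar coordinates glue to one embedded ball

Topic `Topology/FourManifolds` (everything PROVED, no definitions, no named facts). Let
`κ : E ↪ M` be a smooth open embedding of a Euclidean space (a **cap**) and
`ι : Sⁿ × ℝ ↪ M` a smooth open embedding of the cylinder over its unit sphere (a **tube**) which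
agrees with the logarithmic polar coordinates of the cap below a level `a`,
`ι(θ, t) = κ(eᵗ θ)` for `t ≤ a`, and does not come back: `ι(Sⁿ × (a, ∞))` misses the compact
ball `κ(B̄(0, eᵃ))`. Then
`K(x) = κ(x)` for `‖x‖ < eᵃ`, `K(x) = ι(x/‖x‖, log ‖x‖)` for `‖x‖ > e^{a-1}`
is a well-defined smooth open embedding `K : E ↪ M` with range `κ(B(0, eᵃ)) ∪ ι(Sⁿ × ℝ)`,
mapping the sphere of radius `eᵗ` onto the slice `ι(Sⁿ × {t})` (`t > a - 1`)
(`exists_ballEmbedding_of_cappedTube`). This is how an `ε`-cap followed by a chain of `ε`-necks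
ending in half a surgery neck is seen to be a **collared ball piece**
(`Literature.Geometry.Riemannian.IsBallPiece`, `SurgicalRicciFlow.lean`) of a surgically modified
Ricci flow: R. Hamilton, *Four-manifolds with positive isotropic curvature*, Comm. Anal. Geom. 5
(1997), §C2 and §E; B.-L. Chen, X.-P. Zhu, J. Differential Geom. 74 (2006), §5, arXiv p. 24
("If `M⁴` contains a cap `C`, then there is a cap or a neck adjacent to the neck like end of `C` …
we get a new longer cap and continue"). The pointwise agreement `ι(θ, t) = κ(eᵗ θ)` is supplied,
from mere equality of slices, by `Literature.Geometry.Manifold.exists_untwist`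
(`TubeUntwist.lean`); the tube by `Literature.Geometry.Manifold.exists_isSmoothEmbedding_of_heightFunction`
(`TubeChain.lean`). Polar coordinates are those of `NeckCapping.lean`
(`Literature.Topology.FourManifolds.unitDir`, `contMDiffOn_unitDir`).

## References

* R. S. Hamilton, *Four-manifolds with positive isotropic curvature*, Comm. Anal. Geom. 5 (1997)
  1–92, §C2 (p. 31), §E. [Hamilton1997]
* B.-L. Chen, X.-P. Zhu, *Ricci flow with surgery on four-manifolds with positive isotropic
  curvature*, J. Differential Geom. 74 (2006), §5 (arXiv:math/0504478, p. 24). [ChenZhu2006]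
* M. W. Hirsch, *Differential Topology*, GTM 33 (1976), Ch. 8 §1 (gluing along collars). [HirschDT1976]
-/

open scoped Manifold ContDiff Topology
open Set Function Filter Metric Topology Module

noncomputable section

namespace Literature.Topology.FourManifolds

universe u v

section CappedTube

variable {E : Type v} [NormedAddCommGroup E] [InnerProductSpace ℝ E] {n : ℕ}
  [Fact (finrank ℝ E = n + 1)]
  {EM : Type u} [NormedAddCommGroup EM] [NormedSpace ℝ EM] {HM : Type*} [TopologicalSpace HM]
  {I : ModelWithCorners ℝ EM HM} [I.Boundaryless]
  {M : Type*} [TopologicalSpace M] [ChartedSpace HM M] [IsManifold I ∞ M]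

/-- Logarithmic polar coordinates are smooth: `(θ, t) ↦ eᵗ θ : Sⁿ × ℝ → E`. [folklore] -/
theorem contMDiff_expPolar :
    ContMDiff ((𝓡 n).prod 𝓘(ℝ, ℝ)) 𝓘(ℝ, E) ∞
      (fun q : sphere (0 : E) 1 × ℝ ↦ Real.exp q.2 • (q.1 : E)) :=
  (Real.contDiff_exp.comp_contMDiff contMDiff_snd).smul (contMDiff_coe_sphere.comp contMDiff_fst)

/-- `‖eᵗ θ‖ = eᵗ`. [folklore] -/
theorem norm_exp_smul_sphere (θ : sphere (0 : E) 1) (t : ℝ) : ‖Real.exp t • (θ : E)‖ = Real.exp t := by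
  rw [norm_smul, mem_sphere_zero_iff_norm.1 θ.2, mul_one, Real.norm_eq_abs,
    abs_of_pos (Real.exp_pos t)]

/-- The inverse logarithmic polar coordinates `x ↦ (x/‖x‖, log ‖x‖)` are smooth off the origin.
[folklore] -/
theorem contMDiffOn_logPolar (θ₀ : sphere (0 : E) 1) :
    ContMDiffOn 𝓘(ℝ, E) ((𝓡 n).prod 𝓘(ℝ, ℝ)) ∞
      (fun x : E ↦ ((unitDir θ₀ x : sphere (0 : E) 1), Real.log ‖x‖)) {0}ᶜ := by
  refine (contMDiffOn_unitDir θ₀).prodMk ?_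
  rw [contMDiffOn_iff_contDiffOn]
  exact fun x hx ↦ ((contDiffAt_norm ℝ hx).log (norm_ne_zero_iff.2 hx)).contDiffWithinAt

/-- `(unitDir (eᵗ θ), log ‖eᵗ θ‖) = (θ, t)`. [folklore] -/
theorem logPolar_expPolar (θ₀ θ : sphere (0 : E) 1) (t : ℝ) :
    ((unitDir θ₀ (Real.exp t • (θ : E)) : sphere (0 : E) 1), Real.log ‖Real.exp t • (θ : E)‖) =
      (θ, t) := by
  rw [unitDir_smul θ₀ θ (Real.exp_pos t), norm_exp_smul_sphere, Real.log_exp]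

/-- `e^{log ‖x‖} (x/‖x‖) = x` for `x ≠ 0`. [folklore] -/
theorem expPolar_logPolar (θ₀ : sphere (0 : E) 1) {x : E} (hx : x ≠ 0) :
    Real.exp (Real.log ‖x‖) • (unitDir θ₀ x : E) = x := by
  rw [Real.exp_log (norm_pos_iff.2 hx), norm_smul_coe_unitDir θ₀ hx]

/-- **A cap and a tube agreeing in polar coordinates glue to one embedded ball.** Let
`κ : E ↪ M` (cap) and `ι : Sⁿ × ℝ ↪ M` (tube) be smooth embeddings with open ranges into a
manifold over a boundaryless model whose model space is identified with `E` by `L`, such that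
`ι(θ, t) = κ(eᵗ θ)` for `t ≤ a` and `ι(Sⁿ × (a, ∞))` is disjoint from `κ(B̄(0, eᵃ))`. Then there is
a smooth embedding `K : E ↪ M` with open range `κ(B(0, eᵃ)) ∪ ι(Sⁿ × ℝ)`, equal to `κ` on
`B(0, eᵃ)` and with `K(eᵗ θ) = ι(θ, t)` for `t > a - 1` (so the sphere of radius `eᵗ` goes onto the
slice `ι(Sⁿ × {t})`). [cite: Hamilton1997, §3.2 (C2), p. 31] [cite: ChenZhu2006, §5, p. 24]
[cite: HirschDT1976, Ch. 8 §1] -/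
theorem exists_ballEmbedding_of_cappedTube
    {κ : E → M} (hκ : Manifold.IsSmoothEmbedding 𝓘(ℝ, E) I ∞ κ) (hκo : IsOpen (range κ))
    {ι : sphere (0 : E) 1 × ℝ → M} (hι : Manifold.IsSmoothEmbedding ((𝓡 n).prod 𝓘(ℝ, ℝ)) I ∞ ι)
    (hιo : IsOpen (range ι)) {a : ℝ}
    (hagree : ∀ (θ : sphere (0 : E) 1) (t : ℝ), t ≤ a → ι (θ, t) = κ (Real.exp t • (θ : E)))
    (hfar : Disjoint (ι '' (univ ×ˢ Ioi a)) (κ '' closedBall 0 (Real.exp a)))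
    (L : E ≃L[ℝ] EM) :
    ∃ K : E → M, Manifold.IsSmoothEmbedding 𝓘(ℝ, E) I ∞ K ∧ IsOpen (range K) ∧
      range K = κ '' ball 0 (Real.exp a) ∪ range ι ∧
      (∀ x : E, ‖x‖ < Real.exp a → K x = κ x) ∧
      ∀ (θ : sphere (0 : E) 1) (t : ℝ), a - 1 < t → K (Real.exp t • (θ : E)) = ι (θ, t) := by
  classical
  haveI : Nonempty (sphere (0 : E) 1) := ⟨unitSpherePoint n⟩
  set θ₀ : sphere (0 : E) 1 := unitSpherePoint n with hθ₀
  have hκinj : Injective κ := hκ.isEmbedding.injective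
  have hιinj : Injective ι := hι.isEmbedding.injective
  -- the polar part
  set P : E → M := fun x ↦ ι ((unitDir θ₀ x : sphere (0 : E) 1), Real.log ‖x‖) with hP
  have hPexp : ∀ (θ : sphere (0 : E) 1) (t : ℝ), P (Real.exp t • (θ : E)) = ι (θ, t) := by
    intro θ t
    show ι ((unitDir θ₀ (Real.exp t • (θ : E)) : sphere (0 : E) 1),
      Real.log ‖Real.exp t • (θ : E)‖) = ι (θ, t)
    rw [logPolar_expPolar θ₀ θ t]
  -- every `x ≠ 0` is `eᵗ θ`
  have hpolar : ∀ x : E, x ≠ 0 →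
      ∃ (θ : sphere (0 : E) 1) (t : ℝ), x = Real.exp t • (θ : E) ∧ Real.exp t = ‖x‖ := fun x hx ↦
    ⟨unitDir θ₀ x, Real.log ‖x‖, (expPolar_logPolar θ₀ hx).symm, Real.exp_log (norm_pos_iff.2 hx)⟩
  -- agreement of `κ` and `P` on the shell `e^{a-1} < ‖x‖`, `‖x‖ < eᵃ` (indeed for `‖x‖ ≤ eᵃ`)
  have hagree' : ∀ x : E, x ≠ 0 → ‖x‖ ≤ Real.exp a → P x = κ x := by
    intro x hx hxa
    obtain ⟨θ, t, rfl, het⟩ := hpolar x hx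
    rw [hPexp, hagree θ t]
    rwa [← Real.exp_le_exp, het]
  -- the glued map
  set K : E → M := fun x ↦ if ‖x‖ < Real.exp a then κ x else P x with hK
  have hKκ : ∀ x : E, ‖x‖ < Real.exp a → K x = κ x := fun x hx ↦ by simp only [hK, if_pos hx]
  have hKP : ∀ x : E, Real.exp (a - 1) < ‖x‖ → K x = P x := by
    intro x hx
    by_cases h : ‖x‖ < Real.exp a
    · rw [hKκ x h]
      have hx0 : x ≠ 0 := by
        rw [← norm_pos_iff]; exact lt_trans (Real.exp_pos _) hx
      exact (hagree' x hx0 h.le).symm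
    · simp only [hK, if_neg h]
  have hKexp : ∀ (θ : sphere (0 : E) 1) (t : ℝ), a - 1 < t → K (Real.exp t • (θ : E)) = ι (θ, t) := by
    intro θ t ht
    rw [hKP _ (by rw [norm_exp_smul_sphere]; exact Real.exp_lt_exp.2 ht), hPexp]
  -- the two open pieces of the source
  set A : Set E := ball 0 (Real.exp a) with hA
  set B : Set E := (closedBall (0 : E) (Real.exp (a - 1)))ᶜ with hB
  have hAo : IsOpen A := isOpen_ball
  have hBo : IsOpen B := isClosed_closedBall.isOpen_compl
  have hB0 : B ⊆ {0}ᶜ := fun x hx h0 ↦ hx (by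
    rw [mem_singleton_iff] at h0; simp [h0, (Real.exp_pos _).le])
  have hmemA : ∀ x : E, x ∈ A ↔ ‖x‖ < Real.exp a := fun x ↦ by simp [hA]
  have hmemB : ∀ x : E, x ∈ B ↔ Real.exp (a - 1) < ‖x‖ := fun x ↦ by simp [hB]
  have hcover : ∀ x : E, x ∈ A ∨ x ∈ B := fun x ↦ by
    by_cases h : ‖x‖ < Real.exp a
    · exact Or.inl ((hmemA x).2 h)
    · refine Or.inr ((hmemB x).2 (lt_of_lt_of_le (Real.exp_lt_exp.2 (by linarith)) (not_lt.1 h)))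
  have hKA : EqOn K κ A := fun x hx ↦ hKκ x ((hmemA x).1 hx)
  have hKB : EqOn K P B := fun x hx ↦ hKP x ((hmemB x).1 hx)
  -- smoothness
  have hPs : ContMDiffOn 𝓘(ℝ, E) I ∞ P {0}ᶜ :=
    hι.contMDiff.comp_contMDiffOn (contMDiffOn_logPolar θ₀)
  have hKs : ContMDiff 𝓘(ℝ, E) I ∞ K := by
    intro x
    rcases hcover x with hx | hx
    · exact ((hκ.contMDiff.contMDiffOn.congr hKA) x hx).contMDiffAt (hAo.mem_nhds hx)
    · exact (((hPs.mono hB0).congr hKB) x hx).contMDiffAt (hBo.mem_nhds hx)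
  -- injectivity
  have hPinj : ∀ x y : E, x ≠ 0 → y ≠ 0 → P x = P y → x = y := by
    intro x y hx hy h
    have h' := hιinj h
    rw [Prod.mk.injEq] at h'
    rw [← expPolar_logPolar θ₀ hx, ← expPolar_logPolar θ₀ hy, h'.1, h'.2]
  have hKinj : Injective K := by
    intro x y hxy
    by_cases hx : ‖x‖ < Real.exp a <;> by_cases hy : ‖y‖ < Real.exp a
    · rw [hKκ x hx, hKκ y hy] at hxy; exact hκinj hxy
    · -- `x` in the ball, `y` outside
      exfalso
      rw [hKκ x hx] at hxy
      simp only [hK, if_neg hy] at hxy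
      have hy0 : y ≠ 0 := by rw [← norm_pos_iff]; exact lt_of_lt_of_le (Real.exp_pos a) (not_lt.1 hy)
      obtain ⟨θ, t, rfl, het⟩ := hpolar y hy0
      rw [hPexp] at hxy
      rcases (not_lt.1 hy).eq_or_lt with heq | hlt
      · -- `‖y‖ = eᵃ`: then `ι(θ, a) = κ y`, contradicting injectivity of `κ`
        have hta : t = a := Real.exp_injective (by rw [het, ← heq])
        rw [hta, hagree θ a le_rfl] at hxy
        have := hκinj hxy
        rw [this, norm_exp_smul_sphere] at hx
        exact lt_irrefl _ hx
      · have hta : a < t := by rw [← Real.exp_lt_exp, het]; exact hlt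
        refine hfar.le_bot ⟨⟨(θ, t), ⟨mem_univ _, hta⟩, rfl⟩, ?_⟩
        rw [← hxy]
        exact ⟨x, mem_closedBall_zero_iff.2 hx.le, rfl⟩
    · exfalso
      rw [hKκ y hy] at hxy
      simp only [hK, if_neg hx] at hxy
      have hx0 : x ≠ 0 := by rw [← norm_pos_iff]; exact lt_of_lt_of_le (Real.exp_pos a) (not_lt.1 hx)
      obtain ⟨θ, t, rfl, het⟩ := hpolar x hx0
      rw [hPexp] at hxy
      rcases (not_lt.1 hx).eq_or_lt with heq | hlt
      · have hta : t = a := Real.exp_injective (by rw [het, ← heq])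
        rw [hta, hagree θ a le_rfl] at hxy
        have := hκinj hxy
        rw [← this, norm_exp_smul_sphere] at hy
        exact lt_irrefl _ hy
      · have hta : a < t := by rw [← Real.exp_lt_exp, het]; exact hlt
        refine hfar.le_bot ⟨⟨(θ, t), ⟨mem_univ _, hta⟩, rfl⟩, ?_⟩
        rw [hxy]
        exact ⟨y, mem_closedBall_zero_iff.2 hy.le, rfl⟩
    · simp only [hK, if_neg hx, if_neg hy] at hxy
      have hx0 : x ≠ 0 := by rw [← norm_pos_iff]; exact lt_of_lt_of_le (Real.exp_pos a) (not_lt.1 hx)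
      have hy0 : y ≠ 0 := by rw [← norm_pos_iff]; exact lt_of_lt_of_le (Real.exp_pos a) (not_lt.1 hy)
      exact hPinj x y hx0 hy0 hxy
  -- `K` is an open map: on `A` it is `κ`, on `B` it is `ι` after a homeomorphism onto an open set
  have hκom : IsOpenMap κ := (⟨hκ.isEmbedding, hκo⟩ : IsOpenEmbedding κ).isOpenMap
  have hιom : IsOpenMap ι := (⟨hι.isEmbedding, hιo⟩ : IsOpenEmbedding ι).isOpenMap
  have hlogPolar_open : ∀ S : Set E, IsOpen S → S ⊆ {0}ᶜ →
      IsOpen ((fun x : E ↦ ((unitDir θ₀ x : sphere (0 : E) 1), Real.log ‖x‖)) '' S) := by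
    intro S hS hS0
    have heq : (fun x : E ↦ ((unitDir θ₀ x : sphere (0 : E) 1), Real.log ‖x‖)) '' S =
        (fun q : sphere (0 : E) 1 × ℝ ↦ Real.exp q.2 • (q.1 : E)) ⁻¹' S := by
      ext ⟨θ, t⟩
      constructor
      · rintro ⟨x, hx, hxq⟩
        rw [mem_preimage]
        have hx0 : x ≠ 0 := hS0 hx
        rw [Prod.mk.injEq] at hxq
        rw [← hxq.1, ← hxq.2, expPolar_logPolar θ₀ hx0]
        exact hx
      · intro h
        exact ⟨_, h, logPolar_expPolar θ₀ θ t⟩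
    rw [heq]
    exact hS.preimage (contMDiff_expPolar (n := n)).continuous
  have hKom : IsOpenMap K := by
    intro S hS
    have hsplit : K '' S = κ '' (S ∩ A) ∪ P '' (S ∩ B) := by
      apply Subset.antisymm
      · rintro _ ⟨x, hx, rfl⟩
        rcases hcover x with hxA | hxB
        · exact Or.inl ⟨x, ⟨hx, hxA⟩, (hKA hxA).symm⟩
        · exact Or.inr ⟨x, ⟨hx, hxB⟩, (hKB hxB).symm⟩
      · rintro y (⟨x, ⟨hx, hxA⟩, rfl⟩ | ⟨x, ⟨hx, hxB⟩, rfl⟩)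
        · exact ⟨x, hx, hKA hxA⟩
        · exact ⟨x, hx, hKB hxB⟩
    rw [hsplit]
    refine (hκom _ (hS.inter hAo)).union ?_
    have : P '' (S ∩ B) = ι '' ((fun x : E ↦ ((unitDir θ₀ x : sphere (0 : E) 1), Real.log ‖x‖)) ''
        (S ∩ B)) := by rw [image_image]
    rw [this]
    exact hιom _ (hlogPolar_open _ (hS.inter hBo) (inter_subset_right.trans hB0))
  have hKoe : IsOpenEmbedding K :=
    IsOpenEmbedding.of_continuous_injective_isOpenMap hKs.continuous hKinj hKom
  -- the range
  have hrange : range K = κ '' ball 0 (Real.exp a) ∪ range ι := by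
    apply Subset.antisymm
    · rintro _ ⟨x, rfl⟩
      by_cases hx : ‖x‖ < Real.exp a
      · exact Or.inl ⟨x, mem_ball_zero_iff.2 hx, (hKκ x hx).symm⟩
      · simp only [hK, if_neg hx]
        exact Or.inr (mem_range_self _)
    · rintro y (⟨x, hx, rfl⟩ | ⟨⟨θ, t⟩, rfl⟩)
      · exact ⟨x, hKκ x (mem_ball_zero_iff.1 hx)⟩
      · rcases lt_or_ge (a - 1) t with ht | ht
        · exact ⟨Real.exp t • (θ : E), hKexp θ t ht⟩
        · refine ⟨Real.exp t • (θ : E), ?_⟩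
          rw [hKκ _ (by rw [norm_exp_smul_sphere]; exact Real.exp_lt_exp.2 (by linarith)),
            ← hagree θ t (by linarith)]
  -- the inverse, smooth on the range
  set back : M → E := fun y ↦ Real.exp (invFun ι y).2 • ((invFun ι y).1 : E) with hback
  have hbacks : ContMDiffOn I 𝓘(ℝ, E) ∞ back (range ι) :=
    (contMDiff_expPolar (n := n)).comp_contMDiffOn (Literature.Geometry.Manifold.contMDiffOn_invFun_range hι)
  have hback_ι : ∀ q, back (ι q) = Real.exp q.2 • (q.1 : E) := fun q ↦ by
    simp only [hback, leftInverse_invFun hιinj q]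
  set Kinv : M → E := fun y ↦ if y ∈ κ '' A then invFun κ y else back y with hKinv
  -- `Kinv` inverts `K`
  have hT'sub : ι '' (univ ×ˢ Ioi (a - 1)) ⊆ range K := by
    rintro _ ⟨⟨θ, t⟩, ⟨-, ht⟩, rfl⟩; exact ⟨_, hKexp θ t ht⟩
  have hKinv_T : ∀ y ∈ ι '' (univ ×ˢ Ioi (a - 1)), Kinv y = back y := by
    rintro _ ⟨⟨θ, t⟩, ⟨-, ht : a - 1 < t⟩, rfl⟩
    by_cases hy : ι (θ, t) ∈ κ '' A
    · simp only [hKinv, if_pos hy]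
      obtain ⟨x, hxA, hx⟩ := hy
      have h1 : K x = K (Real.exp t • (θ : E)) := by
        rw [hKκ x ((hmemA x).1 hxA), hx, hKexp θ t ht]
      have h2 : x = Real.exp t • (θ : E) := hKinj h1
      rw [hback_ι, ← hx, leftInverse_invFun hκinj x, h2]
    · simp only [hKinv, if_neg hy]
  have hKinv_A : ∀ y ∈ κ '' A, Kinv y = invFun κ y := fun y hy ↦ by simp only [hKinv, if_pos hy]
  have hleft : ∀ x, Kinv (K x) = x := by
    intro x
    by_cases hx : ‖x‖ < Real.exp a
    · rw [hKκ x hx, hKinv_A _ ⟨x, (hmemA x).2 hx, rfl⟩, leftInverse_invFun hκinj]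
    · have hx0 : x ≠ 0 := by
        rw [← norm_pos_iff]; exact lt_of_lt_of_le (Real.exp_pos a) (not_lt.1 hx)
      obtain ⟨θ, t, rfl, het⟩ := hpolar x hx0
      have ht : a - 1 < t := by
        have : Real.exp a ≤ Real.exp t := by rw [het]; exact not_lt.1 hx
        have := Real.exp_le_exp.1 this
        linarith
      rw [hKexp θ t ht, hKinv_T _ ⟨(θ, t), ⟨mem_univ _, ht⟩, rfl⟩, hback_ι]
  -- smoothness of `Kinv` on `range K`
  have hκAo : IsOpen (κ '' A) := hκom _ hAo
  have hT'o : IsOpen (ι '' (univ ×ˢ Ioi (a - 1))) := hιom _ (isOpen_univ.prod isOpen_Ioi)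
  have hKinvs : ContMDiffOn I 𝓘(ℝ, E) ∞ Kinv (range K) := by
    intro y hy
    have hcov : y ∈ κ '' A ∨ y ∈ ι '' (univ ×ˢ Ioi (a - 1)) := by
      obtain ⟨x, rfl⟩ := hy
      rcases hcover x with hxA | hxB
      · exact Or.inl ⟨x, hxA, (hKA hxA).symm⟩
      · right
        have hx0 : x ≠ 0 := hB0 hxB
        obtain ⟨θ, t, rfl, het⟩ := hpolar x hx0
        have ht : a - 1 < t := by
          rw [← Real.exp_lt_exp, het]; exact (hmemB _).1 hxB
        exact ⟨(θ, t), ⟨mem_univ _, ht⟩, (hKexp θ t ht).symm⟩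
    rcases hcov with hyA | hyT
    · have h1 : ContMDiffOn I 𝓘(ℝ, E) ∞ (invFun κ) (κ '' A) :=
        (Literature.Geometry.Manifold.contMDiffOn_invFun_range hκ).mono (image_subset_range _ _)
      have h2 : ContMDiffOn I 𝓘(ℝ, E) ∞ Kinv (κ '' A) := h1.congr fun z hz ↦ hKinv_A z hz
      exact ((h2 y hyA).contMDiffAt (hκAo.mem_nhds hyA)).contMDiffWithinAt
    · have h1 : ContMDiffOn I 𝓘(ℝ, E) ∞ back (ι '' (univ ×ˢ Ioi (a - 1))) :=
        hbacks.mono (image_subset_range _ _)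
      have h2 : ContMDiffOn I 𝓘(ℝ, E) ∞ Kinv (ι '' (univ ×ˢ Ioi (a - 1))) :=
        h1.congr fun z hz ↦ hKinv_T z hz
      exact ((h2 y hyT).contMDiffAt (hT'o.mem_nhds hyT)).contMDiffWithinAt
  -- the embedding
  set Q := hKoe.toOpenPartialHomeomorph K with hQ
  have hQsymm : ContMDiffOn I 𝓘(ℝ, E) ∞ Q.symm Q.target := by
    rw [hKoe.toOpenPartialHomeomorph_target]
    refine hKinvs.congr ?_
    rintro _ ⟨x, rfl⟩
    rw [hKoe.toOpenPartialHomeomorph_left_inv, hleft]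
  have hemb : Manifold.IsSmoothEmbedding 𝓘(ℝ, E) I ∞ K :=
    isSmoothEmbedding_of_openPartialHomeomorph Q (hKoe.toOpenPartialHomeomorph_source K)
      (by rw [hKoe.toOpenPartialHomeomorph_source]; exact hKs.contMDiffOn) hQsymm L
  exact ⟨K, hemb, hKoe.isOpen_range, hrange, hKκ, hKexp⟩

end CappedTube

end Literature.Topology.FourManifolds

end
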